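import Mathlib
import Literature.Analysis.ODE.OneSidedComparison

/-!
# Perturbation of a linear flow in the generator (solo-blind s80, §24.90(12): the (L-cont) lemma)

R5 = (c1) computes the (MB) certificate on the slice `(κ, y) = (0⁺, y*)` and continues it by
`resolvent_bound_near_slice` (kernel #142), whose input is joint continuity of the monodromy
`M(P, z)`.  That continuity is the present estimate: if `U' = A(t) U` and `W' = B(t) W` on `[0, T]`
with `U 0 = W 0`, `‖A t‖ ≤ K`, `‖B t − A t‖ ≤ ε`, `‖W t‖ ≤ R`, then
`‖U t − W t‖ ≤ gronwallBound 0 K (ε R) t ≤ ε R t e^{K t}` — so `z ↦ M(P, z) = W_z(T)` is continuous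
wherever the generator depends continuously on `z` uniformly in `t` (Mathlib's
`dist_le_of_approx_trajectories_ODE` with the linear vector field `x ↦ A t * x`).

(`e^x − 1 ≤ x e^x` and `gronwallBound δ K ε x ≤ (δ + ε x) e^{K x}` are cited from
`Literature.Analysis.ODE.OneSidedComparison`.)
* `linear_flow_perturbation` — the Grönwall estimate above (values in a normed algebra).
* `linear_flow_perturbation'` — the explicit form `‖U t − W t‖ ≤ ε R t e^{K t}`.
-/

open Set Metric Real

namespace Summit.AnomalousDissipation.AnomalousDissipation.Theorems

variable {𝔸 : Type*} [NormedRing 𝔸] [NormedAlgebra ℝ 𝔸]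

/-- **Perturbation of a linear flow in the generator (Grönwall).**  On `[0, T]` let
`U' = A t * U t` and `W' = B t * W t` (right derivatives), `U, W` continuous, `U 0 = W 0`,
with `‖A t‖ ≤ K`, `‖B t − A t‖ ≤ ε` and `‖W t‖ ≤ R` for `t ∈ [0, T)`.  Then
`‖U t − W t‖ ≤ gronwallBound 0 K (ε R) t` for all `t ∈ [0, T]`. -/
theorem linear_flow_perturbation {A B U W : ℝ → 𝔸} {T K ε R : ℝ} (hK : 0 ≤ K)
    (hU : ContinuousOn U (Icc 0 T)) (hW : ContinuousOn W (Icc 0 T))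
    (hU' : ∀ t ∈ Ico 0 T, HasDerivWithinAt U (A t * U t) (Ici t) t)
    (hW' : ∀ t ∈ Ico 0 T, HasDerivWithinAt W (B t * W t) (Ici t) t)
    (h0 : U 0 = W 0)
    (hA : ∀ t ∈ Ico 0 T, ‖A t‖ ≤ K) (hBA : ∀ t ∈ Ico 0 T, ‖B t - A t‖ ≤ ε)
    (hWR : ∀ t ∈ Ico 0 T, ‖W t‖ ≤ R) :
    ∀ t ∈ Icc 0 T, ‖U t - W t‖ ≤ gronwallBound 0 K (ε * R) t := by
  -- the linear vector field x ↦ A t * x is K-Lipschitz on [0, T); outside we use the zero field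
  classical
  let v : ℝ → 𝔸 → 𝔸 := fun t x => if t ∈ Ico 0 T then A t * x else 0
  have hv : ∀ t, LipschitzWith ⟨K, hK⟩ (v t) := by
    intro t
    by_cases ht : t ∈ Ico 0 T
    · refine LipschitzWith.of_dist_le_mul fun x y => ?_
      simp only [v, if_pos ht, dist_eq_norm, ← mul_sub]
      calc ‖A t * (x - y)‖ ≤ ‖A t‖ * ‖x - y‖ := norm_mul_le _ _
        _ ≤ K * ‖x - y‖ := mul_le_mul_of_nonneg_right (hA t ht) (norm_nonneg _)
        _ = (⟨K, hK⟩ : NNReal) * ‖x - y‖ := rfl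
    · have hvt : v t = fun _ => (0 : 𝔸) := funext fun x => if_neg ht
      rw [hvt]; exact (LipschitzWith.const (0 : 𝔸)).weaken bot_le
  have hf_bound : ∀ t ∈ Ico 0 T, dist (A t * U t) (v t (U t)) ≤ 0 := by
    intro t ht; simp only [v, if_pos ht, dist_self, le_refl]
  have hg_bound : ∀ t ∈ Ico 0 T, dist (B t * W t) (v t (W t)) ≤ ε * R := by
    intro t ht
    simp only [v, if_pos ht, dist_eq_norm, ← sub_mul]
    have hε : 0 ≤ ε := le_trans (norm_nonneg _) (hBA t ht)
    calc ‖(B t - A t) * W t‖ ≤ ‖B t - A t‖ * ‖W t‖ := norm_mul_le _ _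
      _ ≤ ε * R := mul_le_mul (hBA t ht) (hWR t ht) (norm_nonneg _) hε
  have ha : dist (U 0) (W 0) ≤ 0 := by simp [h0]
  have := dist_le_of_approx_trajectories_ODE hv hU hU' hf_bound hW hW' hg_bound ha
  intro t ht
  have h := this t ht
  rw [zero_add, sub_zero, dist_eq_norm] at h
  exact h

/-- The explicit form: `‖U t − W t‖ ≤ ε R t e^{K t}` on `[0, T]` (with `0 ≤ ε`, `0 ≤ R`). -/
theorem linear_flow_perturbation' {A B U W : ℝ → 𝔸} {T K ε R : ℝ} (hK : 0 ≤ K) (hε : 0 ≤ ε)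
    (hR : 0 ≤ R)
    (hU : ContinuousOn U (Icc 0 T)) (hW : ContinuousOn W (Icc 0 T))
    (hU' : ∀ t ∈ Ico 0 T, HasDerivWithinAt U (A t * U t) (Ici t) t)
    (hW' : ∀ t ∈ Ico 0 T, HasDerivWithinAt W (B t * W t) (Ici t) t)
    (h0 : U 0 = W 0)
    (hA : ∀ t ∈ Ico 0 T, ‖A t‖ ≤ K) (hBA : ∀ t ∈ Ico 0 T, ‖B t - A t‖ ≤ ε)
    (hWR : ∀ t ∈ Ico 0 T, ‖W t‖ ≤ R) :
    ∀ t ∈ Icc 0 T, ‖U t - W t‖ ≤ ε * R * t * exp (K * t) := by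
  intro t ht
  have h := linear_flow_perturbation hK hU hW hU' hW' h0 hA hBA hWR t ht
  have hg := Literature.Analysis.ODE.gronwallBound_le_mul_exp (δ := 0) (x := t) (mul_nonneg hε hR) hK
  rw [zero_add] at hg
  exact h.trans (by simpa [mul_assoc] using hg)

end Summit.AnomalousDissipation.AnomalousDissipation.Theorems
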